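import Summits.NavierStokesRegularity.NavierStokesRegularity.Theorems.SoloInformedGronwallRigidity

/-!
# Grönwall rigidity under an energy-type constraint

Solo seat `solo-NavierStokesRegularity-informed` (paper §3.1, Theorem L7, SCOPE (ii)). An a priori
estimate for Clay (A) is proved along Leray solutions, i.e. only for fields obeying side
constraints such as `∫|u|² ≤ E₀`. This file removes the corresponding objection to
`SoloInformedGronwallRigidity`: the differential inequality `ν A(u) + B(u) ≤ ∑ⱼ Rⱼ(u)` is assumed
only on a constraint set `P`, and the sole hypothesis on `P` is that the Navier–Stokes zoom
`T (s * t) t u` ("`u ↦ (s t) • u(t ·)`") enters `P` for all large `t` — which is what every sublevel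
set of a quantity of negative Navier–Stokes weight (the energy: law `l ^ 2 * m ^ (-3)`, so
`(s t)² t⁻³ → 0`) satisfies. Conclusion unchanged: `B ≡ 0` (exact Euler conservation law) and
`ν A ≤ 0`, now on ALL of `X`. Tools: an `eventually` form of the isolation lemma, and the
unconstrained theorems applied with no bound terms (`J = PEmpty`) once `ν A + B ≤ 0` has been
extracted at amplitude `s = 1` (one bundled statement `gronwallRigidity_of_subcriticalBoundOn`). Elementary. [folklore-level; no source]
-/

noncomputable section

open Filter Topology Finset
open scoped BigOperators

namespace Summit.NavierStokesRegularity.NavierStokesRegularity.Theorems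

section IsolationEventually

variable {κ : Type*} [Fintype κ]

/-- **Isolation of the top exponent, asymptotic form.** If `∑ₖ cₖ s ^ rₖ ≤ 0` for all sufficiently
large `s` and `r k₀` strictly exceeds every other exponent, then `c k₀ ≤ 0`. [folklore] -/
theorem coeff_nonpos_of_exponent_lt_eventually (c r : κ → ℝ) (k₀ : κ)
    (hmax : ∀ k, k ≠ k₀ → r k < r k₀)
    (h : ∀ᶠ s : ℝ in atTop, ∑ k, c k * s ^ (r k) ≤ 0) : c k₀ ≤ 0 := by
  classical
  have hlim : Tendsto (fun s : ℝ => ∑ k, c k * s ^ (r k - r k₀)) atTop (𝓝 (c k₀)) := by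
    have hc : c k₀ = ∑ k, (if k = k₀ then c k₀ else 0) := by simp
    rw [hc]
    refine tendsto_finsetSum _ fun k _ => ?_
    by_cases hk : k = k₀
    · subst hk
      simp only [sub_self, Real.rpow_zero, mul_one, if_true]
      exact tendsto_const_nhds
    · simp only [hk, if_false]
      have hpos : 0 < r k₀ - r k := by linarith [hmax k hk]
      have ht := (tendsto_rpow_neg_atTop hpos).const_mul (c k)
      rw [mul_zero] at ht
      refine ht.congr' ?_
      filter_upwards [eventually_gt_atTop (0 : ℝ)] with s hs
      congr 1
      rw [neg_sub]
  refine le_of_tendsto hlim ?_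
  filter_upwards [h, eventually_gt_atTop (0 : ℝ)] with s hs hs0
  have hfac : ∑ k, c k * s ^ (r k - r k₀) = s ^ (-r k₀) * ∑ k, c k * s ^ (r k) := by
    rw [Finset.mul_sum]
    refine Finset.sum_congr rfl fun k _ => ?_
    rw [Real.rpow_sub hs0, Real.rpow_neg hs0.le, div_eq_mul_inv]
    ring
  rw [hfac]
  exact mul_nonpos_of_nonneg_of_nonpos (Real.rpow_nonneg hs0.le _) hs

end IsolationEventually

section Constrained

variable {X J : Type*} [Fintype J]

variable (T : ℝ → ℝ → X → X) (neg : X → X) (P : X → Prop) (ν d e : ℝ) (A B : X → ℝ)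
  (dR eR : J → ℝ) (R : J → X → ℝ)
  (hS : ∀ (l m : ℝ) (u : X), 0 < l → 0 < m → A (T l m u) = l ^ d * m ^ (e + 2) * A u)
  (hE : ∀ (l m : ℝ) (u : X), 0 < l → 0 < m → B (T l m u) = l ^ (d + 1) * m ^ (e + 1) * B u)
  (hR : ∀ (j : J) (l m : ℝ) (u : X), 0 < l → 0 < m →
    R j (T l m u) = l ^ (dR j) * m ^ (eR j) * R j u)
  (hod : ∀ u, B (neg u) = -B u)
  (hw : ∀ j, dR j + eR j < d + e + 2)
  (hP : ∀ (u : X) (s : ℝ), 0 < s → ∀ᶠ t : ℝ in atTop, P (T (s * t) t u))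
  (hineq : ∀ u, P u → ν * A u + B u ≤ ∑ j, R j u)

include hS hE hR hw hP hineq in
/-- **Constrained bound ⇒ plain formal dissipativity.** If the subcritical bound holds on a set `P`
which every Navier–Stokes zoom `T (s * t) t u` enters for large `t`, then for every `u` (constrained
or not) and every amplitude `s > 0`, `ν s ^ d A u + s ^ (d + 1) B u ≤ 0` (the zoom kills the bound:
isolation of the top `t`-exponent, asymptotic form); at `s = 1` this is `ν A u + B u ≤ 0` on ALL of
`X`, to which the unconstrained file applies with no bound terms. [folklore] -/
theorem dissipative_of_subcriticalBoundOn (u : X) : ν * A u + B u ≤ 0 := by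
  have step : ∀ s : ℝ, 0 < s → ν * (s ^ d * A u) + s ^ (d + 1) * B u ≤ 0 := by
    intro s hs
    classical
    have key := coeff_nonpos_of_exponent_lt_eventually (κ := Option J)
      (fun k => Option.elim k (ν * (s ^ d * A u) + s ^ (d + 1) * B u)
        (fun j => -(s ^ (dR j) * R j u)))
      (fun k => Option.elim k (d + e + 2) (fun j => dR j + eR j)) none ?_ ?_
    · simpa using key
    · intro k hk
      obtain ⟨j, rfl⟩ := Option.ne_none_iff_exists'.mp hk
      simpa using hw j
    · filter_upwards [hP u s hs, eventually_gt_atTop (0 : ℝ)] with t hPt ht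
      have hst : 0 < s * t := mul_pos hs ht
      have hR' : ∀ j, R j (T (s * t) t u) = (s * t) ^ (dR j) * t ^ (eR j) * R j u :=
        fun j => hR j _ _ u hst ht
      have h := hineq (T (s * t) t u) hPt
      rw [hS _ _ u hst ht, hE _ _ u hst ht] at h
      simp only [hR'] at h
      have hsum : ∑ j, (-(s ^ (dR j) * R j u)) * t ^ (dR j + eR j)
          = -∑ j, (s * t) ^ (dR j) * t ^ (eR j) * R j u := by
        rw [← Finset.sum_neg_distrib]
        refine Finset.sum_congr rfl fun j _ => ?_
        rw [Real.mul_rpow hs.le ht.le, Real.rpow_add ht]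
        ring
      have hA' : (s * t) ^ d * t ^ (e + 2) = s ^ d * t ^ (d + e + 2) := by
        rw [Real.mul_rpow hs.le ht.le, show d + e + 2 = d + (e + 2) by ring, Real.rpow_add ht d (e + 2)]
        ring
      have hB' : (s * t) ^ (d + 1) * t ^ (e + 1) = s ^ (d + 1) * t ^ (d + e + 2) := by
        rw [Real.mul_rpow hs.le ht.le, show d + e + 2 = (d + 1) + (e + 1) by ring,
          Real.rpow_add ht (d + 1) (e + 1)]
        ring
      have main : (ν * (s ^ d * A u) + s ^ (d + 1) * B u) * t ^ (d + e + 2)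
          + ∑ j, (-(s ^ (dR j) * R j u)) * t ^ (dR j + eR j) ≤ 0 := by
        rw [hsum]
        rw [hA', hB'] at h
        have h' := sub_nonpos.mpr h
        have eq : (ν * (s ^ d * A u) + s ^ (d + 1) * B u) * t ^ (d + e + 2)
            + -∑ j, (s * t) ^ (dR j) * t ^ (eR j) * R j u
            = ν * (s ^ d * t ^ (d + e + 2) * A u) + s ^ (d + 1) * t ^ (d + e + 2) * B u
              - ∑ j, (s * t) ^ (dR j) * t ^ (eR j) * R j u := by ring
        rw [eq]
        exact h'
      simpa [Fintype.sum_option] using main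
  simpa using step 1 one_pos

include hS hE hR hod hw hP hineq in
/-- **Constrained Grönwall rigidity.** Although the subcritical bound was only assumed on the
constraint set `P`, the quantity is an exact Euler conservation law (`B ≡ 0`) with the Stokes sign
(`ν A ≤ 0`) on all of `X`: the unconstrained theorems of `SoloInformedGronwallRigidity` applied with
no bound terms (`J = PEmpty`) to the dissipativity extracted above. (Paper §3.1, L7 SCOPE (ii).)
[folklore] -/
theorem gronwallRigidity_of_subcriticalBoundOn : (∀ u, B u = 0) ∧ ∀ u, ν * A u ≤ 0 := by
  have hd := dissipative_of_subcriticalBoundOn T P ν d e A B dR eR R hS hE hR hw hP hineq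
  refine ⟨?_, ?_⟩
  · exact eulerRate_eq_zero_of_subcriticalBound (J := PEmpty.{1}) (T := T) (neg := neg) (ν := ν)
      (d := d) (e := e) (A := A) (B := B) (dR := fun j => j.elim) (eR := fun j => j.elim)
      (R := fun j => j.elim) hS hE (fun j => j.elim) hod (fun j => j.elim)
      (fun u => by simpa using hd u)
  · exact stokesRate_nonpos_of_subcriticalBound (J := PEmpty.{1}) (T := T) (ν := ν)
      (d := d) (e := e) (A := A) (B := B) (dR := fun j => j.elim) (eR := fun j => j.elim)
      (R := fun j => j.elim) hS hE (fun j => j.elim) (fun j => j.elim)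
      (fun u => by simpa using hd u)

/-- The energy-type constraint is admissible: a sublevel set `{u | G u ≤ c}`, `0 < c`, of a quantity
with law `l ^ dG * m ^ eG` of negative Navier–Stokes weight `dG + eG < 0` is entered by every zoom
`T (s * t) t u` for large `t`. [folklore] -/
theorem eventually_sublevel_of_negWeight (G : X → ℝ) (dG eG c : ℝ)
    (hG : ∀ (l m : ℝ) (u : X), 0 < l → 0 < m → G (T l m u) = l ^ dG * m ^ eG * G u)
    (hwG : dG + eG < 0) (hc : 0 < c) (u : X) (s : ℝ) (hs : 0 < s) :
    ∀ᶠ t : ℝ in atTop, G (T (s * t) t u) ≤ c := by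
  have hlim : Tendsto (fun t : ℝ => s ^ dG * G u * t ^ (dG + eG)) atTop (𝓝 0) := by
    have h0 := (tendsto_rpow_neg_atTop (show 0 < -(dG + eG) by linarith)).const_mul (s ^ dG * G u)
    rw [mul_zero] at h0
    refine h0.congr' ?_
    filter_upwards [eventually_gt_atTop (0 : ℝ)] with t ht
    rw [neg_neg]
  have hev := (hlim.eventually (gt_mem_nhds hc))
  filter_upwards [hev, eventually_gt_atTop (0 : ℝ)] with t ht ht0
  have hst : 0 < s * t := mul_pos hs ht0
  rw [hG _ _ u hst ht0, Real.mul_rpow hs.le ht0.le]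
  rw [Real.rpow_add ht0] at ht
  have : s ^ dG * t ^ dG * t ^ eG * G u = s ^ dG * G u * (t ^ dG * t ^ eG) := by ring
  rw [this]
  exact ht.le

end Constrained

end Summit.NavierStokesRegularity.NavierStokesRegularity.Theorems
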